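import Literature.Analysis.FluidPDE.CriticalSpacesProofs
import Literature.Analysis.FluidPDE.VectorCalculus
import Literature.Analysis.FunctionSpaces.BesovWeakStarLimits
import HarnessLib

/-!
# Distributional derivatives of fields with weak gradients

Analysis/FluidPDE proof file (theorems only: no definition, no named fact). The glue between the
tree's Sobolev-type weak gradients (`HasWeakGradient f G`: integration by parts against real
compactly supported smooth test functions, Evans, *PDE*, §5.2.1) and Mathlib's distributional
derivatives `∂_v W` of the tempered distribution `W` of the field `f` (`IsDistributionOf`):

* `integral_fderiv_smul_complexify_eq_neg_of_hasWeakGradient` — the integration-by-parts identity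
  `∫ (∂_v θ) • f = -∫ θ • (G · v)` for **complex, compactly supported** Schwartz functions `θ`
  (real and imaginary parts are real test functions);
* `IsDistributionOf.lineDeriv_eq_of_hasWeakGradient` — **`∂_v W` is the distribution of the weak
  partial derivative `x ↦ G x v`** whenever the latter has a tempered distribution `W_v`
  (e.g. `G · v ∈ L^p`): the two distributions agree on compactly supported Schwartz functions,
  which determine a tempered distribution
  (`FunctionSpaces.TemperedDistribution.eq_of_forall_hasCompactSupport_apply_eq`);
* `IsDistributionOf.lineDeriv_of_hasWeakGradient_of_memLp` — the `L^p` case packaged: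
  `IsDistributionOf (G · v) (∂_v W)`.

This extends the tree's `C¹` statement `IsDistributionOf.lineDeriv` to Sobolev fields, as needed
to feed the reverse-Bernstein / high-frequency bounds (`BesovHighFrequencyTail.lean`,
`‖u - Ṡ_N u‖_{L²} ≲ 2^{-N} ∑_i ‖∂_i u‖_{L²}`) with the `H¹_loc` slices of blow-up limits of suitable
weak solutions (W. Wang, Z. Zhang, arXiv:1510.02589, §4 Step 1, the use of Lemma 3.2).

## References

* L. C. Evans, *Partial Differential Equations* (2010), §5.2.1 (weak derivatives). [Evans2010]
* W. Wang, Z. Zhang, Sci. China Math. 60 (2017) 637–650 = arXiv:1510.02589, §4 Step 1.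
  [WangZhang2016]
-/

noncomputable section

open MeasureTheory Filter Set Function TopologicalSpace
open _root_.Topology
open scoped SchwartzMap ENNReal NNReal LineDeriv

namespace Literature.Analysis.FluidPDE

open FunctionSpaces.EuclideanSpace (complexify)

variable {ι : Type*} [Fintype ι] {E : Type*} [NormedAddCommGroup E] [InnerProductSpace ℝ E]
  [FiniteDimensional ℝ E] [MeasurableSpace E] [BorelSpace E]

/-! ## Real and imaginary parts of compactly supported Schwartz functions are test functions -/

omit [FiniteDimensional ℝ E] [MeasurableSpace E] [BorelSpace E] in
/-- The real part of a compactly supported Schwartz function is a real test function on the whole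
space, with directional derivatives the real parts of those of `θ`. [folklore] -/
theorem isTestFunctionOn_re_of_hasCompactSupport (θ : 𝓢(E, ℂ))
    (hθ : HasCompactSupport (θ : E → ℂ)) :
    FunctionSpaces.IsTestFunctionOn (⊤ : Opens E) (fun x => (θ x).re) ∧
      ∀ x v, fderiv ℝ (fun x => (θ x).re) x v = (fderiv ℝ (θ : E → ℂ) x v).re := by
  have hd : ∀ x, HasFDerivAt (fun x => (θ x).re) (Complex.reCLM.comp (fderiv ℝ (θ : E → ℂ) x)) x :=
    fun x => Complex.reCLM.hasFDerivAt.comp x θ.differentiableAt.hasFDerivAt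
  refine ⟨⟨Complex.reCLM.contDiff.comp (θ.smooth _), hθ.comp_left Complex.zero_re, by simp⟩,
    fun x v => ?_⟩
  rw [(hd x).fderiv]
  rfl

omit [FiniteDimensional ℝ E] [MeasurableSpace E] [BorelSpace E] in
/-- The imaginary part of a compactly supported Schwartz function is a real test function on the
whole space, with directional derivatives the imaginary parts of those of `θ`. [folklore] -/
theorem isTestFunctionOn_im_of_hasCompactSupport (θ : 𝓢(E, ℂ))
    (hθ : HasCompactSupport (θ : E → ℂ)) :
    FunctionSpaces.IsTestFunctionOn (⊤ : Opens E) (fun x => (θ x).im) ∧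
      ∀ x v, fderiv ℝ (fun x => (θ x).im) x v = (fderiv ℝ (θ : E → ℂ) x v).im := by
  have hd : ∀ x, HasFDerivAt (fun x => (θ x).im) (Complex.imCLM.comp (fderiv ℝ (θ : E → ℂ) x)) x :=
    fun x => Complex.imCLM.hasFDerivAt.comp x θ.differentiableAt.hasFDerivAt
  refine ⟨⟨Complex.imCLM.contDiff.comp (θ.smooth _), hθ.comp_left Complex.zero_im, by simp⟩,
    fun x v => ?_⟩
  rw [(hd x).fderiv]
  rfl

/-! ## Integration by parts against complex compactly supported Schwartz functions -/

omit [FiniteDimensional ℝ E] [BorelSpace E] in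
/-- Complexification and real scalars: `(a : ℂ) • complexify w = complexify (a • w)` and the
complex combination `(a + b i) • complexify w = complexify (a • w) + i • complexify (b • w)`.
[folklore] -/
theorem ofReal_add_mul_I_smul_complexify (a b : ℝ) (w : EuclideanSpace ℝ ι) :
    ((a : ℂ) + (b : ℂ) * Complex.I) • complexify w =
      complexify (a • w) + Complex.I • complexify (b • w) := by
  rw [add_smul, map_smul, map_smul, Complex.coe_smul, mul_comm, mul_smul, Complex.coe_smul]

/-- A weak partial derivative `x ↦ G x v` of a field with weak gradient is locally integrable.
[folklore] -/
theorem locallyIntegrable_apply_of_hasWeakGradient {f : E → EuclideanSpace ℝ ι}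
    {G : E → E →L[ℝ] EuclideanSpace ℝ ι} (hG : HasWeakGradient f G) (v : E) :
    LocallyIntegrable (fun x => G x v) volume := by
  have hGl : LocallyIntegrable G volume := locallyIntegrableOn_univ.1 hG.locallyIntegrableOn_deriv
  rw [locallyIntegrable_iff] at hGl ⊢
  intro K hK
  exact (ContinuousLinearMap.apply ℝ (EuclideanSpace ℝ ι) v).integrable_comp (hGl K hK)

/-- **Integration by parts against complex, compactly supported Schwartz functions**: for a field
`f` with weak gradient `G` (Evans §5.2.1, real test functions), `∫ (∂_v θ) • f = -∫ θ • (G · v)`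
for every compactly supported Schwartz `θ : E → ℂ` (split `θ` into real and imaginary parts).
[cite: Evans2010, §5.2.1] -/
theorem integral_fderiv_smul_complexify_eq_neg_of_hasWeakGradient {f : E → EuclideanSpace ℝ ι}
    {G : E → E →L[ℝ] EuclideanSpace ℝ ι} (hG : HasWeakGradient f G) (θ : 𝓢(E, ℂ))
    (hθ : HasCompactSupport (θ : E → ℂ)) (v : E) :
    ∫ x, (fderiv ℝ (θ : E → ℂ) x v) • complexify (f x) = -∫ x, θ x • complexify (G x v) := by
  obtain ⟨hre, hre'⟩ := isTestFunctionOn_re_of_hasCompactSupport θ hθ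
  obtain ⟨him, him'⟩ := isTestFunctionOn_im_of_hasCompactSupport θ hθ
  set a : E → ℝ := fun x => (θ x).re with ha
  set b : E → ℝ := fun x => (θ x).im with hb
  set a' : E → ℝ := fun x => fderiv ℝ a x v with ha'
  set b' : E → ℝ := fun x => fderiv ℝ b x v with hb'
  -- the real integration-by-parts identities
  have hIa : ∫ x, a' x • f x = -∫ x, a x • G x v := by
    simpa only [Measure.restrict_univ, Opens.coe_top] using hG.integral_fderiv_smul_eq a v hre
  have hIb : ∫ x, b' x • f x = -∫ x, b x • G x v := by
    simpa only [Measure.restrict_univ, Opens.coe_top] using hG.integral_fderiv_smul_eq b v him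
  -- local integrability and compactly supported continuous weights
  have hfl : LocallyIntegrable f volume := locallyIntegrableOn_univ.1 hG.locallyIntegrableOn
  have hGv : LocallyIntegrable (fun x => G x v) volume := locallyIntegrable_apply_of_hasWeakGradient hG v
  have hac : Continuous a := Complex.continuous_re.comp θ.continuous
  have hbc : Continuous b := Complex.continuous_im.comp θ.continuous
  have ha'c : Continuous a' := (hre.contDiff.continuous_fderiv (by simp)).clm_apply continuous_const
  have hb'c : Continuous b' := (him.contDiff.continuous_fderiv (by simp)).clm_apply continuous_const
  have has : HasCompactSupport a := hre.hasCompactSupport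
  have hbs : HasCompactSupport b := him.hasCompactSupport
  have ha's : HasCompactSupport a' := hre.hasCompactSupport.fderiv_apply (𝕜 := ℝ) v
  have hb's : HasCompactSupport b' := him.hasCompactSupport.fderiv_apply (𝕜 := ℝ) v
  have i1 : Integrable (fun x => a' x • f x) := hfl.integrable_smul_left_of_hasCompactSupport ha'c ha's
  have i2 : Integrable (fun x => b' x • f x) := hfl.integrable_smul_left_of_hasCompactSupport hb'c hb's
  have i3 : Integrable (fun x => a x • G x v) := hGv.integrable_smul_left_of_hasCompactSupport hac has
  have i4 : Integrable (fun x => b x • G x v) := hGv.integrable_smul_left_of_hasCompactSupport hbc hbs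
  -- complexify both sides
  set c := (FunctionSpaces.EuclideanSpace.complexify (ι := ι)).toContinuousLinearMap with hc
  have hcapp : ∀ w, c w = complexify w := fun _ => rfl
  have hL : ∀ x, (fderiv ℝ (θ : E → ℂ) x v) • complexify (f x) =
      c (a' x • f x) + Complex.I • c (b' x • f x) := by
    intro x
    rw [hcapp, hcapp, ← ofReal_add_mul_I_smul_complexify]
    simp only [ha', hb', hre', him', Complex.re_add_im]
  have hR : ∀ x, θ x • complexify (G x v) = c (a x • G x v) + Complex.I • c (b x • G x v) := by
    intro x
    rw [hcapp, hcapp, ← ofReal_add_mul_I_smul_complexify, ha, hb, Complex.re_add_im]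
  simp_rw [hL, hR]
  have j1 : Integrable (fun x => c (a' x • f x)) := c.integrable_comp i1
  have j2 : Integrable (fun x => Complex.I • c (b' x • f x)) := (c.integrable_comp i2).smul Complex.I
  have j3 : Integrable (fun x => c (a x • G x v)) := c.integrable_comp i3
  have j4 : Integrable (fun x => Complex.I • c (b x • G x v)) := (c.integrable_comp i4).smul Complex.I
  rw [integral_add j1 j2, integral_add j3 j4, integral_smul, integral_smul, c.integral_comp_comm i1,
    c.integral_comp_comm i2, c.integral_comp_comm i3, c.integral_comp_comm i4, hIa, hIb, map_neg,
    map_neg, smul_neg, neg_add]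

/-! ## The distributional derivative is the distribution of the weak derivative -/

/-- **`∂_v W` is the distribution of the weak partial derivative.** Let `W` be the tempered
distribution of a field `f` with weak gradient `G` (`HasWeakGradient f G`), and let `W_v` be the
tempered distribution of the weak partial derivative `x ↦ G x v`. Then `∂_v W = W_v`: both are
tempered distributions which agree on compactly supported Schwartz functions
(`integral_fderiv_smul_complexify_eq_neg_of_hasWeakGradient`), and such functions determine a
tempered distribution (`FunctionSpaces.TemperedDistribution.eq_of_forall_hasCompactSupport_apply_eq`).
[cite: Evans2010, §5.2.1] -/
theorem IsDistributionOf.lineDeriv_eq_of_hasWeakGradient {f : E → EuclideanSpace ℝ ι}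
    {G : E → E →L[ℝ] EuclideanSpace ℝ ι} {W Wv : 𝓢'(E, EuclideanSpace ℂ ι)}
    (hW : IsDistributionOf f W) (hG : HasWeakGradient f G) (v : E)
    (hWv : IsDistributionOf (fun x => G x v) Wv) : ∂_{v} W = Wv := by
  refine FunctionSpaces.TemperedDistribution.eq_of_forall_hasCompactSupport_apply_eq fun θ hθ => ?_
  rw [TemperedDistribution.lineDerivOp_apply_apply, (hW (-∂_{v} θ)).2, (hWv θ).2]
  simp only [neg_apply, SchwartzMap.lineDerivOp_apply_eq_fderiv, neg_smul, integral_neg]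
  rw [integral_fderiv_smul_complexify_eq_neg_of_hasWeakGradient hG θ hθ v, neg_neg]

/-- **The `L^p` case, packaged**: if the weak partial derivative `x ↦ G x v` of a field `f` with
tempered distribution `W` lies in `L^p` (`1 ≤ p`), then `∂_v W` is its distribution:
`IsDistributionOf (G · v) (∂_v W)` (so e.g. `‖∂_v W‖_{L^p} = ‖G · v‖_{L^p}`,
`IsDistributionOf.eLpNormDistrib_eq`). [cite: Evans2010, §5.2.1] -/
theorem IsDistributionOf.lineDeriv_of_hasWeakGradient_of_memLp {f : E → EuclideanSpace ℝ ι}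
    {G : E → E →L[ℝ] EuclideanSpace ℝ ι} {W : 𝓢'(E, EuclideanSpace ℂ ι)}
    (hW : IsDistributionOf f W) (hG : HasWeakGradient f G) (v : E) {p : ℝ≥0∞} [Fact (1 ≤ p)]
    (hGv : MemLp (fun x => G x v) p volume) :
    IsDistributionOf (fun x => G x v) (∂_{v} W) := by
  obtain ⟨Wv, hWv⟩ := exists_isDistributionOf_of_memLp hGv
  rw [hW.lineDeriv_eq_of_hasWeakGradient hG v hWv]
  exact hWv

end Literature.Analysis.FluidPDE

end
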